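import Literature.Topology.FourManifolds.KirbyMovesSlideEndData2
import Literature.Topology.FourManifolds.KirbyMovesSlideEndAngleLift
import Literature.Topology.FourManifolds.KirbyMovesSlideEndCircleFun
import HarnessLib

/-!
# Normalising the band end, step A: the rotation angle along the attaching arc

Topic `Literature/Topology/FourManifolds`; fact seat `provefact-IsStrictHandleSlide.isSurgery`
(R. C. Kirby, *The Topology of 4-Manifolds*, LNM 1374 (1989), Ch. I §4; remaining content: the
named fact (S) `Literature.Topology.FourManifolds.FramedLink.IsStrictHandleSlide.slideModel`).
The end of the slide band at the push-off `Kⱼ' = ν (·, e₀)` is made radial by rotating the tube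
about the circle `C₀ = S¹ × {e₀}` (`exists_tubeIsotopy_rotationAboutPushOff`); this file produces
the **angle of that rotation as a smooth function on the circle**, with values in `[0, 1]` after
scaling by a constant `M > 0`, supported over the attaching arc, and such that at the base point
`circlePt (thetaB y)` of height `y ∈ [h₁, h₂]` the rotation by the angle `M β` carries the normal
derivative `V(y) = D W (1, y) (1, 0)` of the band end (`KirbyMovesSlideEndData2.lean`: `V(y) ≠ 0`)
to a *negative* multiple of `e₀` (the band side `x₀ < 1` then leaves `Kⱼ'` radially outwards).
Proved here, no definitions, no named facts:

* `Literature.Topology.FourManifolds.BandCore.contDiffOn_tubeNormalDeriv` — `V` is `C^∞` on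
  `(1/10, 9/10)`;
* `Literature.Topology.FourManifolds.BandCore.exists_rotationAngleFun` — the angle function `β`
  and the scale `M` (smooth angle of `V/‖V‖` by `SlideSweep.exists_smooth_angle`, shifted by a
  multiple of `2π` to be positive, cut off by a plateau in the parameter of `Kⱼ'` and descended to
  the circle by `SlideSweep.exists_contMDiff_circle_of_window`).

## References

* R. C. Kirby, *The Topology of 4-Manifolds*, LNM 1374, Springer (1989), Ch. I §4. [Kirby1989]
* M. W. Hirsch, *Differential Topology*, GTM 33 (1976), Ch. 4 §5, Ch. 8 §1. [HirschDT1976]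
-/

open scoped Manifold ContDiff Topology
open Function Set Metric

noncomputable section

namespace Literature.Topology.FourManifolds

namespace BandCore

variable [Knot.TubularNbhd.SmoothnessFacts] {A Kj : Knot} (ν : Knot.TubularNbhd Kj)
  {avoid : Set (Metric.sphere (0 : EuclideanSpace ℝ (Fin 4)) 1)} (b : BandCore A ν.pushOff avoid)

/-- **The normal derivative of the band end along the edge is smooth**: `y ↦ D W (1, y) (1, 0)` is
`C^∞` on `(1/10, 9/10)`. [folklore] -/
theorem contDiffOn_tubeNormalDeriv :
    ContDiffOn ℝ ∞ (fun y : ℝ ↦ fderiv ℝ (fun x ↦ (ν.toTubeNbhd.toHomeo.symm (b.band x)).2) (pt2 1 y) (pt2 1 0))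
      (Ioo (10⁻¹ : ℝ) (9 / 10)) := by
  have hO := b.isOpen_preimage_range_tube ν
  have hW := b.contDiffOn_tubeNormal' ν
  have hD : ContDiffOn ℝ ∞ (fderiv ℝ (fun x ↦ (ν.toTubeNbhd.toHomeo.symm (b.band x)).2))
      (b.band ⁻¹' range ⇑ν) := hW.fderiv_of_isOpen hO le_rfl
  have hline : ContDiff ℝ ∞ (fun y : ℝ ↦ pt2 1 y) := by
    rw [contDiff_euclidean]
    intro i; fin_cases i
    · exact contDiff_const
    · exact contDiff_id
  have hmaps : MapsTo (fun y : ℝ ↦ pt2 1 y) (Ioo (10⁻¹ : ℝ) (9 / 10)) (b.band ⁻¹' range ⇑ν) :=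
    fun y hy ↦ b.band_pt2_one_mem_range ν (Ioo_subset_Icc_self hy)
  have hcomp := hD.comp hline.contDiffOn hmaps
  exact (ContinuousLinearMap.apply ℝ (EuclideanSpace ℝ (Fin 2)) (pt2 1 0)).contDiff.comp_contDiffOn hcomp

omit [Knot.TubularNbhd.SmoothnessFacts] in
/-- A smooth plateau: for `p < q ≤ r < s'` the function
`χ t = smoothTransition ((t - p)/(q - p)) · smoothTransition ((s' - t)/(s' - r))` is `C^∞`, takes
values in `[0, 1]`, equals `1` on `[q, r]` and `0` off `(p, s')`. [folklore] -/
theorem plateau_props {p q r s' : ℝ} (hpq : p < q) (hrs : r < s') :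
    ContDiff ℝ ∞ (fun t ↦ Real.smoothTransition ((t - p) / (q - p)) * Real.smoothTransition ((s' - t) / (s' - r))) ∧
      (∀ t, Real.smoothTransition ((t - p) / (q - p)) * Real.smoothTransition ((s' - t) / (s' - r)) ∈ Icc (0 : ℝ) 1) ∧
      (∀ t ∈ Icc q r, Real.smoothTransition ((t - p) / (q - p)) * Real.smoothTransition ((s' - t) / (s' - r)) = 1) ∧
      (∀ t, t ∉ Ioo p s' → Real.smoothTransition ((t - p) / (q - p)) * Real.smoothTransition ((s' - t) / (s' - r)) = 0) := by
  refine ⟨?_, fun t ↦ ?_, fun t ht ↦ ?_, fun t ht ↦ ?_⟩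
  · exact (Real.smoothTransition.contDiff.comp ((contDiff_id.sub contDiff_const).div_const _)).mul
      (Real.smoothTransition.contDiff.comp ((contDiff_const.sub contDiff_id).div_const _))
  · exact ⟨mul_nonneg (Real.smoothTransition.nonneg _) (Real.smoothTransition.nonneg _),
      mul_le_one₀ (Real.smoothTransition.le_one _) (Real.smoothTransition.nonneg _)
        (Real.smoothTransition.le_one _)⟩
  · rw [Real.smoothTransition.one_of_one_le, Real.smoothTransition.one_of_one_le, one_mul]
    · rw [le_div_iff₀ (by linarith)]; linarith [ht.2]
    · rw [le_div_iff₀ (by linarith)]; linarith [ht.1]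
  · rcases le_or_gt t p with h | h
    · rw [Real.smoothTransition.zero_of_nonpos, zero_mul]
      exact div_nonpos_of_nonpos_of_nonneg (by linarith) (by linarith)
    · have h2 : s' ≤ t := by
        by_contra h2; exact ht ⟨h, not_le.1 h2⟩
      rw [mul_comm, Real.smoothTransition.zero_of_nonpos, zero_mul]
      exact div_nonpos_of_nonpos_of_nonneg (by linarith) (by linarith)

/-- **The rotation angle along the attaching arc, as a smooth function on the circle.** For
heights `1/10 < h₁ ≤ h₂ < 9/10` there are a `C^∞` function `β : S¹ → [0, 1]` and `M > 0` such
that `β u ≠ 0` only over the open right-edge window (`u = circlePt s`,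
`thetaB (9/10) < s < thetaB (1/10)`), and for every `y ∈ [h₁, h₂]`, with
`V = D W (1, y) (1, 0)` the normal derivative of the band end and `θ = M β (circlePt (thetaB y))`:
`cos θ • V + sin θ • J V = -(2‖V‖) • e₀`. [cite: Kirby1989, Ch. I §4] -/
theorem exists_rotationAngleFun {h₁ h₂ : ℝ} (hh₁ : 10⁻¹ < h₁) (hh : h₁ ≤ h₂) (hh₂ : h₂ < 9 / 10) :
    ∃ (β : Metric.sphere (0 : EuclideanSpace ℝ (Fin 2)) 1 → ℝ) (M : ℝ),
      ContMDiff (𝓡 1) 𝓘(ℝ, ℝ) ∞ β ∧ 0 < M ∧ (∀ u, β u ∈ Icc (0 : ℝ) 1) ∧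
      (∀ u, β u ≠ 0 → ∃ s ∈ Ioo (b.thetaB (9 / 10)) (b.thetaB 10⁻¹), u = circlePt s) ∧
      ∀ y ∈ Icc h₁ h₂,
        Real.cos (M * β (circlePt (b.thetaB y))) •
            fderiv ℝ (fun x ↦ (ν.toTubeNbhd.toHomeo.symm (b.band x)).2) (pt2 1 y) (pt2 1 0) +
          Real.sin (M * β (circlePt (b.thetaB y))) •
            ((-(fderiv ℝ (fun x ↦ (ν.toTubeNbhd.toHomeo.symm (b.band x)).2) (pt2 1 y) (pt2 1 0) 1)) •
                EuclideanSpace.single (0 : Fin 2) (1 : ℝ) +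
              (fderiv ℝ (fun x ↦ (ν.toTubeNbhd.toHomeo.symm (b.band x)).2) (pt2 1 y) (pt2 1 0) 0) •
                EuclideanSpace.single 1 1) =
          (-(2 * ‖fderiv ℝ (fun x ↦ (ν.toTubeNbhd.toHomeo.symm (b.band x)).2) (pt2 1 y) (pt2 1 0)‖)) •
            framingBaseVector := by
  -- the normal derivative `V`, smooth and nonvanishing on `(1/10, 9/10)`
  set V : ℝ → EuclideanSpace ℝ (Fin 2) :=
    fun y ↦ fderiv ℝ (fun x ↦ (ν.toTubeNbhd.toHomeo.symm (b.band x)).2) (pt2 1 y) (pt2 1 0) with hV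
  have hVs : ContDiffOn ℝ ∞ V (Ioo (10⁻¹ : ℝ) (9 / 10)) := b.contDiffOn_tubeNormalDeriv ν
  have hV0 : ∀ y ∈ Ioo (10⁻¹ : ℝ) (9 / 10), V y ≠ 0 := fun y hy ↦ b.fderiv_tubeNormal_ne_zero ν hy
  have hI : IsOpen (Ioo (10⁻¹ : ℝ) (9 / 10)) := isOpen_Ioo
  -- the normalised field and its smooth angle
  set d : ℝ → EuclideanSpace ℝ (Fin 2) := fun y ↦ ‖V y‖⁻¹ • V y with hd
  have hds : ContDiffOn ℝ ∞ d (Ioo (10⁻¹ : ℝ) (9 / 10)) := by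
    intro y hy
    have hVy : ContDiffAt ℝ ∞ V y := hVs.contDiffAt (hI.mem_nhds hy)
    exact ((hVy.norm ℝ (hV0 y hy)).inv (norm_ne_zero_iff.2 (hV0 y hy))).smul hVy |>.contDiffWithinAt
  have hd1 : ∀ y ∈ Ioo (10⁻¹ : ℝ) (9 / 10), ‖d y‖ = 1 := fun y hy ↦ by
    simp only [hd, norm_smul, norm_inv, norm_norm]
    exact inv_mul_cancel₀ (norm_ne_zero_iff.2 (hV0 y hy))
  obtain ⟨α, hαs, hα⟩ := SlideSweep.exists_smooth_angle hds hd1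
  -- `V = ‖V‖ (cos α, sin α)`
  have hVeq : ∀ y ∈ Ioo (10⁻¹ : ℝ) (9 / 10),
      V y 0 = ‖V y‖ * Real.cos (α y) ∧ V y 1 = ‖V y‖ * Real.sin (α y) := by
    intro y hy
    obtain ⟨h0, h1⟩ := hα y hy
    have hn : ‖V y‖ ≠ 0 := norm_ne_zero_iff.2 (hV0 y hy)
    have e0 : d y 0 = ‖V y‖⁻¹ * V y 0 := by simp [hd]
    have e1 : d y 1 = ‖V y‖⁻¹ * V y 1 := by simp [hd]
    constructor
    · rw [← h0, e0]; field_simp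
    · rw [← h1, e1]; field_simp
  -- enlarged heights window `[h₁', h₂'] ⊆ (1/10, 9/10)`
  set h₁' : ℝ := (10⁻¹ + h₁) / 2 with hh₁'
  set h₂' : ℝ := (h₂ + 9 / 10) / 2 with hh₂'
  have hh₁'I : h₁' ∈ Ioo (10⁻¹ : ℝ) (9 / 10) := ⟨by simp only [hh₁']; linarith, by simp only [hh₁']; linarith⟩
  have hh₂'I : h₂' ∈ Ioo (10⁻¹ : ℝ) (9 / 10) := ⟨by simp only [hh₂']; linarith, by simp only [hh₂']; linarith⟩
  have h1lt : h₁' < h₁ := by simp only [hh₁']; linarith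
  have h2lt : h₂ < h₂' := by simp only [hh₂']; linarith
  have hsub' : Icc h₁' h₂' ⊆ Ioo (10⁻¹ : ℝ) (9 / 10) := fun y hy ↦ ⟨by linarith [hy.1, hh₁'I.1], by linarith [hy.2, hh₂'I.2]⟩
  -- the angle `ψ = π - α`, shifted to be positive and scaled into `[0, 1]` on `[h₁', h₂']`
  have hαc : ContinuousOn α (Icc h₁' h₂') := hαs.continuousOn.mono hsub'
  obtain ⟨B, hB⟩ := (isCompact_Icc (a := h₁') (b := h₂')).exists_bound_of_continuousOn hαc
  have hB0 : 0 ≤ B := le_trans (norm_nonneg _) (hB h₁' ⟨le_rfl, by linarith⟩)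
  obtain ⟨k, hk⟩ : ∃ k : ℕ, B ≤ 2 * Real.pi * k := by
    obtain ⟨k, hk⟩ := exists_nat_ge (B / (2 * Real.pi))
    exact ⟨k, by rw [div_le_iff₀ (by positivity)] at hk; linarith⟩
  set M : ℝ := Real.pi + B + 2 * Real.pi * k + 1 with hM
  have hMpos : 0 < M := by have := Real.pi_pos; simp only [hM]; positivity
  set ψ : ℝ → ℝ := fun y ↦ (Real.pi - α y + 2 * Real.pi * k) / M with hψ
  have hψs : ContDiffOn ℝ ∞ ψ (Ioo (10⁻¹ : ℝ) (9 / 10)) :=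
    ((contDiffOn_const.sub hαs).add contDiffOn_const).div_const _
  have hψI : ∀ y ∈ Icc h₁' h₂', ψ y ∈ Icc (0 : ℝ) 1 := by
    intro y hy
    have hαy : |α y| ≤ B := by simpa [Real.norm_eq_abs] using hB y hy
    have h1 : 0 ≤ Real.pi - α y + 2 * Real.pi * k := by
      have := (abs_le.1 hαy).2; have := Real.pi_pos; nlinarith
    have h2 : Real.pi - α y + 2 * Real.pi * k ≤ M := by
      have := (abs_le.1 hαy).1; simp only [hM]; linarith
    exact ⟨div_nonneg h1 hMpos.le, (div_le_one hMpos).2 h2⟩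
  have hMψ : ∀ y, M * ψ y = Real.pi - α y + 2 * Real.pi * k := fun y ↦ by
    simp only [hψ]; field_simp
  -- the window in the parameter of `Kⱼ'` and the plateau
  have hanti := b.strictAntiOn_thetaB
  have hp : b.thetaB h₂' < b.thetaB h₂ :=
    hanti ⟨by linarith, by linarith⟩ ⟨hh₂'I.1.le, hh₂'I.2.le⟩ h2lt
  have hqr : b.thetaB h₂ ≤ b.thetaB h₁ :=
    hanti.antitoneOn ⟨by linarith, by linarith⟩ ⟨by linarith, by linarith⟩ hh
  have hr : b.thetaB h₁ < b.thetaB h₁' :=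
    hanti ⟨hh₁'I.1.le, hh₁'I.2.le⟩ ⟨by linarith, by linarith⟩ h1lt
  have hlo : b.thetaB (9 / 10) < b.thetaB h₂' :=
    hanti ⟨hh₂'I.1.le, hh₂'I.2.le⟩ ⟨by norm_num, by norm_num⟩ hh₂'I.2
  have hhi : b.thetaB h₁' < b.thetaB 10⁻¹ :=
    hanti ⟨by norm_num, by norm_num⟩ ⟨hh₁'I.1.le, hh₁'I.2.le⟩ hh₁'I.1
  have hwin := b.thetaB_window
  obtain ⟨χ, hχdef⟩ : ∃ χ : ℝ → ℝ, χ = fun t ↦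
      Real.smoothTransition ((t - b.thetaB h₂') / (b.thetaB h₂ - b.thetaB h₂')) *
        Real.smoothTransition ((b.thetaB h₁' - t) / (b.thetaB h₁' - b.thetaB h₁)) := ⟨_, rfl⟩
  have hχs : ContDiff ℝ ∞ χ := by rw [hχdef]; exact (plateau_props hp hr).1
  have hχI : ∀ t, χ t ∈ Icc (0 : ℝ) 1 := by rw [hχdef]; exact (plateau_props hp hr).2.1
  have hχ1 : ∀ t ∈ Icc (b.thetaB h₂) (b.thetaB h₁), χ t = 1 := by rw [hχdef]; exact (plateau_props hp hr).2.2.1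
  have hχ0 : ∀ t, t ∉ Ioo (b.thetaB h₂') (b.thetaB h₁') → χ t = 0 := by
    rw [hχdef]; exact (plateau_props hp hr).2.2.2
  -- heights of window parameters
  have hheight : ∀ s ∈ Ioo (b.thetaB (9 / 10)) (b.thetaB 10⁻¹), b.heightB s ∈ Ioo (10⁻¹ : ℝ) (9 / 10) := by
    intro s hs
    obtain ⟨y, hy, rfl⟩ := b.exists_eq_thetaB hs
    rw [b.heightB_thetaB (Ioo_subset_Icc_self hy)]; exact hy
  have hheight' : ∀ s ∈ Ioo (b.thetaB h₂') (b.thetaB h₁'), b.heightB s ∈ Icc h₁' h₂' := by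
    intro s hs
    have hs' : s ∈ Ioo (b.thetaB (9 / 10)) (b.thetaB 10⁻¹) := ⟨by linarith [hs.1], by linarith [hs.2]⟩
    obtain ⟨y, hy, rfl⟩ := b.exists_eq_thetaB hs'
    rw [b.heightB_thetaB (Ioo_subset_Icc_self hy)]
    constructor
    · by_contra hlt; push Not at hlt
      have := hanti.antitoneOn ⟨hy.1.le, hy.2.le⟩ ⟨hh₁'I.1.le, hh₁'I.2.le⟩ hlt.le
      linarith [hs.2]
    · by_contra hlt; push Not at hlt
      have := hanti.antitoneOn ⟨hh₂'I.1.le, hh₂'I.2.le⟩ ⟨hy.1.le, hy.2.le⟩ hlt.le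
      linarith [hs.1]
  -- the window function `g s = χ s · ψ (heightB s)`
  set g : ℝ → ℝ := fun s ↦ χ s * ψ (b.heightB s) with hg
  have hgs : ContDiff ℝ ∞ g := by
    rw [contDiff_iff_contDiffAt]
    intro s
    by_cases hs : s ∈ Ioo (b.thetaB (9 / 10)) (b.thetaB 10⁻¹)
    · have h1 : ContDiffAt ℝ ∞ b.heightB s := (b.contDiffAt_heightB' hs).1
      have h2 : ContDiffAt ℝ ∞ ψ (b.heightB s) := hψs.contDiffAt (hI.mem_nhds (hheight s hs))
      exact hχs.contDiffAt.mul (h2.comp s h1)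
    · have hfar : s ≤ b.thetaB (9 / 10) ∨ b.thetaB 10⁻¹ ≤ s := by
        by_contra h; push Not at h; exact hs ⟨h.1, h.2⟩
      have hev : g =ᶠ[𝓝 s] fun _ ↦ 0 := by
        rcases hfar with h | h
        · filter_upwards [Iio_mem_nhds (show s < b.thetaB h₂' by linarith)] with t ht
          simp only [hg, hχ0 t (fun h' ↦ by linarith [h'.1, mem_Iio.1 ht]), zero_mul]
        · filter_upwards [Ioi_mem_nhds (show b.thetaB h₁' < s by linarith)] with t ht
          simp only [hg, hχ0 t (fun h' ↦ by linarith [h'.2, mem_Ioi.1 ht]), zero_mul]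
      exact (contDiffAt_const (c := (0 : ℝ))).congr_of_eventuallyEq hev
  have hgI : ∀ s, g s ∈ Icc (0 : ℝ) 1 := by
    intro s
    by_cases hs : s ∈ Ioo (b.thetaB h₂') (b.thetaB h₁')
    · have h1 := hχI s
      have h2 := hψI _ (hheight' s hs)
      exact ⟨mul_nonneg h1.1 h2.1, mul_le_one₀ h1.2 h2.1 h2.2⟩
    · simp only [hg, hχ0 s hs, zero_mul]; exact ⟨le_rfl, zero_le_one⟩
  have hgne : ∀ s, g s ≠ 0 → s ∈ Ioo (b.thetaB h₂') (b.thetaB h₁') := by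
    intro s hs
    by_contra h
    exact hs (by simp only [hg, hχ0 s h, zero_mul])
  -- descend to the circle
  set ε : ℝ := (1 - (b.thetaB h₁' - b.thetaB h₂')) / 2 with hε
  have hεpos : 0 < ε := by simp only [hε]; linarith
  set a : ℝ := b.thetaB h₂' - ε with ha
  have haε : a + ε = b.thetaB h₂' := by simp only [ha]; ring
  have haε' : a + 1 - ε = b.thetaB h₁' := by simp only [ha, hε]; ring
  have hg0 : ∀ s, s ∉ Icc (a + ε) (a + 1 - ε) → g s = 0 := by
    intro s hs
    rw [haε, haε'] at hs
    simp only [hg, hχ0 s (fun h ↦ hs (Ioo_subset_Icc_self h)), zero_mul]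
  obtain ⟨β, hβ, hβper, hβg⟩ := SlideSweep.exists_contMDiff_circle_of_window hgs hεpos hg0
  have hβval' : ∀ u, β u = g (toIcoMod zero_lt_one a (angA u)) := fun u ↦ by
    have h := hβper (angA u)
    rw [circlePt_angA] at h
    rw [h]
    simp only [periodise]
  have hβval : ∀ u, ∃ s, β u = g s := fun u ↦ ⟨_, hβval' u⟩
  refine ⟨β, M, hβ, hMpos, fun u ↦ ?_, fun u hu ↦ ?_, fun y hy ↦ ?_⟩
  · obtain ⟨s, hs⟩ := hβval u; rw [hs]; exact hgI s
  · -- support over the open window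
    set s₀ := toIcoMod zero_lt_one a (angA u) with hs₀
    have hβu : β u = g s₀ := hβval' u
    have hs₀w := hgne s₀ (hβu ▸ hu)
    refine ⟨s₀, ⟨by linarith [hs₀w.1], by linarith [hs₀w.2]⟩, ?_⟩
    obtain ⟨n, hn⟩ : ∃ n : ℤ, toIcoMod zero_lt_one a (angA u) = angA u - n := by
      refine ⟨toIcoDiv zero_lt_one a (angA u), ?_⟩
      rw [toIcoMod]; simp
    rw [hs₀, hn]
    conv_lhs => rw [← circlePt_angA u]
    exact circlePt_eq_circlePt_iff.2 ⟨n, by ring⟩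
  · -- the rotation identity at height `y ∈ [h₁, h₂]`
    have hyI : y ∈ Ioo (10⁻¹ : ℝ) (9 / 10) := ⟨by linarith [hy.1], by linarith [hy.2]⟩
    have hyc : y ∈ Icc (10⁻¹ : ℝ) (9 / 10) := Ioo_subset_Icc_self hyI
    have hs1 : b.thetaB y ∈ Icc (b.thetaB h₂) (b.thetaB h₁) :=
      ⟨hanti.antitoneOn hyc ⟨by linarith, by linarith⟩ hy.2, hanti.antitoneOn ⟨by linarith, by linarith⟩ hyc hy.1⟩
    have hsa : b.thetaB y ∈ Icc a (a + 1) := ⟨by linarith [hs1.1], by linarith [hs1.2]⟩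
    have hβy : β (circlePt (b.thetaB y)) = ψ y := by
      rw [hβg _ hsa]
      simp only [hg]
      rw [hχ1 _ hs1, one_mul, b.heightB_thetaB hyc]
    have hθ : M * β (circlePt (b.thetaB y)) = Real.pi - α y + 2 * Real.pi * k := by rw [hβy, hMψ]
    have hcos : Real.cos (M * β (circlePt (b.thetaB y))) = -Real.cos (α y) := by
      rw [hθ, show Real.pi - α y + 2 * Real.pi * k = (Real.pi - α y) + k * (2 * Real.pi) by ring,
        Real.cos_add_nat_mul_two_pi, Real.cos_pi_sub]
    have hsin : Real.sin (M * β (circlePt (b.thetaB y))) = Real.sin (α y) := by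
      rw [hθ, show Real.pi - α y + 2 * Real.pi * k = (Real.pi - α y) + k * (2 * Real.pi) by ring,
        Real.sin_add_nat_mul_two_pi, Real.sin_pi_sub]
    obtain ⟨hV0', hV1'⟩ := hVeq y hyI
    change Real.cos (M * β (circlePt (b.thetaB y))) • V y +
        Real.sin (M * β (circlePt (b.thetaB y))) •
          ((-(V y 1)) • EuclideanSpace.single (0 : Fin 2) (1 : ℝ) + (V y 0) • EuclideanSpace.single 1 1) =
      (-(2 * ‖V y‖)) • framingBaseVector
    rw [hcos, hsin]
    have hfb : framingBaseVector = (1 / 2 : ℝ) • EuclideanSpace.single (0 : Fin 2) (1 : ℝ) := by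
      ext i; fin_cases i <;> simp [framingBaseVector]
    have key : ∀ c s : ℝ,
        c • V y + s • ((-(V y 1)) • EuclideanSpace.single (0 : Fin 2) (1 : ℝ) + (V y 0) • EuclideanSpace.single 1 1) =
        (c * V y 0 - s * V y 1) • EuclideanSpace.single (0 : Fin 2) (1 : ℝ) +
          (c * V y 1 + s * V y 0) • EuclideanSpace.single 1 1 := by
      intro c s; ext i; fin_cases i <;> simp; ring
    rw [key, hV0', hV1']
    have hcs := Real.cos_sq_add_sin_sq (α y)
    have e1 : -Real.cos (α y) * (‖V y‖ * Real.cos (α y)) - Real.sin (α y) * (‖V y‖ * Real.sin (α y)) = -‖V y‖ := by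
      linear_combination (-‖V y‖) * hcs
    have e2 : -Real.cos (α y) * (‖V y‖ * Real.sin (α y)) + Real.sin (α y) * (‖V y‖ * Real.cos (α y)) = 0 := by
      ring
    rw [e1, e2, zero_smul, add_zero, hfb, smul_smul]
    congr 1
    ring

end BandCore

end Literature.Topology.FourManifolds
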